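import Literature.NumberTheory.EllipticCurves.ZpCorankQuasiIso
import Mathlib.RingTheory.Polynomial.Eisenstein.IsIntegral
import Mathlib.RingTheory.Polynomial.Cyclotomic.Eval
import Mathlib.GroupTheory.Index
import HarnessLib

/-!
# An automorphism of prime order `p` changes the `ℤ_p`-corank by a multiple of `p - 1`

(Sibling of `ZpCorankCyclicAction`, which proves the PARITY statement `corank A ≡ corank A^σ (mod 2)`
for odd `p` through Gauss's product `∏ (1 - X^k) ≡ p (mod Φ_p)`; this file proves the sharper
divisibility `(p - 1) ∣ corank A - corank A^σ` by a different, Eisenstein-polynomial argument, which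
is what identifies the multiplicity `m` in `rk_p(E/F) = rk_p(E/K) + (p - 1)·m` — the quantity `m_ρ`
of Dokchitser–Dokchitser 2010, §4.6 — as a natural number.)

Pure algebra behind Corollary 4.15 of T. Dokchitser, V. Dokchitser, *On the Birch–Swinnerton-Dyer
quotients modulo squares*, Ann. of Math. 172 (2010), 567–596 ("The parity of the `p^∞`-Selmer rank
is unchanged in cyclic `p`-extensions"), whose printed proof is the sentence "A cyclic group of
order `p` has only two `ℚ_p`-irreducible `p`-adic representations, the trivial one and one of
dimension `p - 1`. Thus, [by Lemma 4.14]". On the tree's model of `ℤ_p`-coranks — the formula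
`Literature.NumberTheory.EllipticCurves.zpCorank A p = dim_{𝔽_p} A[p] − dim_{𝔽_p} A/pA` of file
`Selmer`, for `p`-primary abelian groups with finite `p`-torsion ("cofinitely generated",
Greenberg, LNM 1716, §1), with its additivity / quasi-isomorphism invariance of file
`ZpCorankQuasiIso` — the corresponding statement is proved here WITHOUT Pontryagin duality or
representation theory over `ℚ_p`:

* `exists_zpCorank_eq_zpCorank_fixedSub_add` — for an abelian `p`-primary group `A` with `A[p]`
  finite and an endomorphism `σ` with `σ^p = 1` (`p` prime),
  `zpCorank A p = zpCorank A^σ p + (p - 1)·k` for some `k`, where `A^σ = fixedSub σ` is the fixed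
  subgroup; `zpCorank_mod_two_eq_zpCorank_fixedSub_mod_two` — for `p` odd the two coranks have
  the same parity.

The proof: `A^σ × ker N_σ → A`, `(a, b) ↦ a + b` (`N_σ = 1 + σ + ⋯ + σ^(p-1)`, `normEnd`) has kernel
and cokernel killed by `p` (`p·x = N_σ x + (p x − N_σ x)`, `N_σ² = p N_σ`), so
`corank A = corank A^σ + corank ker N_σ` (`ZpCorankQuasiIso`); and a `p`-primary `B` with finite
`B[p]` carrying `τ` with `1 + τ + ⋯ + τ^(p-1) = 0` has corank divisible by `p - 1`
(`exists_zpCorank_eq_mul_of_sum_pow_eq_zero`): with `π = τ − 1`, the Eisenstein property of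
`Φ_p(X + 1) = X^(p-1) + p·Q(X)`, `Q(0) = 1` (Mathlib's `cyclotomic_comp_X_add_one_isEisensteinAt`)
gives `π^(p-1) = −p·Q(π)` on `B` with `Q(π) = 1 + π V(π)` an automorphism (`π` is locally
nilpotent; geometric series), whence, by the multiplicativity of the kernel–cokernel index
`#ker(fg)·[C:fC]·[B:gB] = #ker f·#ker g·[C:fgC]` (`natCard_ker_comp_mul_index`, pure index calculus
from Mathlib's `AddSubgroup.index_map`, `relIndex_sup_left`, `relIndex_ker`) iterated `p − 1`
times, `#B[p]·[B:πB]^(p-1) = (#ker π)^(p-1)·#(B/pB)`; as `ker π ⊆ B[p]` and `B/πB` (a quotient of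
`B/pB`) are finite and killed by `p`, reading orders as powers of `p` gives
`corank B = (p − 1)(a − b)`. (For a cofinitely generated `ℤ_p[ζ_p]`-torsion module this is
`corank_{ℤ_p} = [ℚ_p(ζ_p):ℚ_p] · corank_{ℤ_p[ζ_p]}`.)

Everything here is proved; there is no number theory in this file. It is used for the `p^∞`-Selmer
group of an elliptic curve over a cyclic degree-`p` extension `F/K` with `σ` a generator of
`Gal(F/K)` (Dokchitser–Dokchitser 2010, Lemma 4.14 and Cor. 4.15).

## References

* [DokchitserDokchitserAnnals2010] T. Dokchitser, V. Dokchitser, Ann. of Math. 172 (2010),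
  567–596 = arXiv:math/0610290, §4.4, Lemma 4.14 and Cor. 4.15 (p. 24; arXiv: Lemma 47, Cor. 48).
* [Greenberg1999] R. Greenberg, *Iwasawa theory for elliptic curves*, LNM 1716 (1999), §1
  (cofinitely generated `ℤ_p`-modules and their coranks).
-/

noncomputable section

open Function
open scoped AddSubgroup

namespace Literature.NumberTheory.EllipticCurves

section IndexCalculus

variable {A B C : Type*} [AddCommGroup A] [AddCommGroup B] [AddCommGroup C]

/-! ## The kernel–cokernel index is multiplicative -/

/-- `g(ker (f ∘ g)) = im g ∩ ker f`. [folklore] -/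
theorem map_ker_comp_eq (f : B →+ C) (g : A →+ B) :
    ((f.comp g).ker).map g = g.range ⊓ f.ker := by
  ext y
  simp only [AddSubgroup.mem_map, AddMonoidHom.mem_ker, AddMonoidHom.coe_comp, comp_apply,
    AddSubgroup.mem_inf, AddMonoidHom.mem_range]
  constructor
  · rintro ⟨x, hx, rfl⟩
    exact ⟨⟨x, rfl⟩, hx⟩
  · rintro ⟨⟨x, rfl⟩, hy⟩
    exact ⟨x, hy, rfl⟩

/-- `#ker (f ∘ g) = #ker g · #(im g ∩ ker f)` (`g` maps `ker (f ∘ g)` onto `im g ∩ ker f` with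
kernel `ker g`; Mathlib's `AddSubgroup.relIndex_ker`). [folklore] -/
theorem natCard_ker_comp_eq_mul_natCard_inf (f : B →+ C) (g : A →+ B) :
    Nat.card (f.comp g).ker = Nat.card g.ker * Nat.card ↥(g.range ⊓ f.ker) := by
  have hle : g.ker ≤ (f.comp g).ker := fun x hx ↦ by
    rw [AddMonoidHom.mem_ker] at hx ⊢
    rw [AddMonoidHom.coe_comp, comp_apply, hx, map_zero]
  have h1 := (g.ker.addSubgroupOf (f.comp g).ker).card_mul_index
  rw [Nat.card_congr (AddSubgroup.addSubgroupOfEquivOfLe hle).toEquiv] at h1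
  rw [← h1]
  congr 1
  change g.ker.relIndex (f.comp g).ker = _
  rw [AddSubgroup.relIndex_ker, map_ker_comp_eq]

/-- `#(im g ∩ ker f) · [ker f : im g ∩ ker f] = #ker f`. [folklore] -/
theorem natCard_inf_ker_mul_relIndex (f : B →+ C) (g : A →+ B) :
    Nat.card ↥(g.range ⊓ f.ker) * g.range.relIndex f.ker = Nat.card f.ker := by
  have h1 := ((g.range ⊓ f.ker).addSubgroupOf f.ker).card_mul_index
  rw [Nat.card_congr (AddSubgroup.addSubgroupOfEquivOfLe
    (inf_le_right : g.range ⊓ f.ker ≤ f.ker)).toEquiv] at h1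
  rw [← h1]
  congr 1
  change _ = (g.range ⊓ f.ker).relIndex f.ker
  rw [AddSubgroup.inf_relIndex_right]

/-- **Multiplicativity of the kernel–cokernel index.** For homomorphisms of abelian groups
`g : A → B`, `f : B → C`: `#ker(f∘g) · [C : fB] · [B : gA] = #ker f · #ker g · [C : fgA]` (with
Mathlib's conventions `Nat.card = 0` / `index = 0` for infinite groups, no finiteness is needed):
the six-term kernel–cokernel exact sequence
`0 → ker g → ker fg → ker f → coker g → coker fg → coker f → 0`, counted through
`[C : f(gA)] = [B : gA + ker f]·[C : fB]` (`AddSubgroup.index_map`) and the second isomorphism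
theorem `[gA + ker f : gA] = [ker f : gA ∩ ker f]` (`AddSubgroup.relIndex_sup_left`). [folklore] -/
theorem natCard_ker_comp_mul_index (f : B →+ C) (g : A →+ B) :
    Nat.card (f.comp g).ker * f.range.index * g.range.index =
      Nat.card f.ker * Nat.card g.ker * (f.comp g).range.index := by
  have h2 : (f.comp g).range.index = (g.range ⊔ f.ker).index * f.range.index := by
    rw [← AddMonoidHom.map_range, AddSubgroup.index_map]
  have h3 : g.range.index = g.range.relIndex f.ker * (g.range ⊔ f.ker).index := by
    rw [← AddSubgroup.relIndex_mul_index (le_sup_left : g.range ≤ g.range ⊔ f.ker),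
      AddSubgroup.relIndex_sup_left]
  rw [natCard_ker_comp_eq_mul_natCard_inf, h2, h3, ← natCard_inf_ker_mul_relIndex f g]
  ring

end IndexCalculus

/-! ## Iterating an endomorphism -/

section Iterate

variable {A : Type*} [AddCommGroup A]

/-- For endomorphisms `π ρ` of an abelian group, `π * ρ = π ∘ ρ` in `AddMonoid.End`. [folklore] -/
theorem addMonoidEnd_mul_eq_comp (π ρ : AddMonoid.End A) :
    (π * ρ : AddMonoid.End A) = AddMonoidHom.comp π ρ :=
  rfl

/-- The kernel of the identity endomorphism is trivial, of cardinality `1`. [folklore] -/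
theorem natCard_ker_one : Nat.card (AddMonoidHom.ker (1 : AddMonoid.End A)) = 1 := by
  have h : AddMonoidHom.ker (1 : AddMonoid.End A) = ⊥ := by
    ext x
    rw [AddMonoidHom.mem_ker, AddSubgroup.mem_bot]
    exact Iff.rfl
  rw [h, AddSubgroup.card_bot]

/-- The image of the identity endomorphism is everything, of index `1`. [folklore] -/
theorem index_range_one : (AddMonoidHom.range (1 : AddMonoid.End A)).index = 1 := by
  have h : AddMonoidHom.range (1 : AddMonoid.End A) = ⊤ := by
    ext x
    simp only [AddMonoidHom.mem_range, AddSubgroup.mem_top, iff_true]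
    exact ⟨x, rfl⟩
  rw [h, AddSubgroup.index_top]

/-- If `B/πB` is finite (index `≠ 0`) then so is every `B/π^m B`, and along the way
`index (range π^(m+1)) = d * index (range π^m)` with `d ∣ index (range π)`. [folklore] -/
theorem index_range_pow_ne_zero (π : AddMonoid.End A) (hπ : (AddMonoidHom.range π).index ≠ 0)
    (m : ℕ) : (AddMonoidHom.range (π ^ m)).index ≠ 0 := by
  induction m with
  | zero => rw [pow_zero, index_range_one]; exact one_ne_zero
  | succ m ih =>
    rw [pow_succ, addMonoidEnd_mul_eq_comp, ← AddMonoidHom.map_range, AddSubgroup.index_map]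
    refine mul_ne_zero ?_ ih
    intro h0
    apply hπ
    exact Nat.eq_zero_of_zero_dvd (h0 ▸ AddSubgroup.index_dvd_of_le
      (le_sup_left : AddMonoidHom.range π ≤ AddMonoidHom.range π ⊔ AddMonoidHom.ker (π ^ m)))

/-- **Index of an iterate.** For an endomorphism `π` of an abelian group with `B/πB` finite,
`#ker(π^m) · [B : πB]^m = (#ker π)^m · [B : π^m B]` for every `m` (iterate
`natCard_ker_comp_mul_index`). [folklore] -/
theorem natCard_ker_pow_mul_index_pow (π : AddMonoid.End A) (hπ : (AddMonoidHom.range π).index ≠ 0)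
    (m : ℕ) : Nat.card (AddMonoidHom.ker (π ^ m)) * (AddMonoidHom.range π).index ^ m =
      Nat.card (AddMonoidHom.ker π) ^ m * (AddMonoidHom.range (π ^ m)).index := by
  induction m with
  | zero => rw [pow_zero, pow_zero, pow_zero, natCard_ker_one, index_range_one]
  | succ m ih =>
    have hmul := natCard_ker_comp_mul_index (π ^ m : AddMonoid.End A) (π : AddMonoid.End A)
    rw [← addMonoidEnd_mul_eq_comp, ← pow_succ] at hmul
    have hm := index_range_pow_ne_zero π hπ m
    apply Nat.eq_of_mul_eq_mul_left (Nat.pos_of_ne_zero hm)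
    calc (AddMonoidHom.range (π ^ m)).index *
          (Nat.card (AddMonoidHom.ker (π ^ (m + 1))) * (AddMonoidHom.range π).index ^ (m + 1))
        = (Nat.card (AddMonoidHom.ker (π ^ (m + 1))) * (AddMonoidHom.range (π ^ m)).index *
            (AddMonoidHom.range π).index) * (AddMonoidHom.range π).index ^ m := by ring
      _ = (Nat.card (AddMonoidHom.ker (π ^ m)) * Nat.card (AddMonoidHom.ker π) *
            (AddMonoidHom.range (π ^ (m + 1))).index) * (AddMonoidHom.range π).index ^ m := by
          rw [hmul]
      _ = Nat.card (AddMonoidHom.ker π) * (AddMonoidHom.range (π ^ (m + 1))).index *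
            (Nat.card (AddMonoidHom.ker (π ^ m)) * (AddMonoidHom.range π).index ^ m) := by ring
      _ = (AddMonoidHom.range (π ^ m)).index *
          (Nat.card (AddMonoidHom.ker π) ^ (m + 1) * (AddMonoidHom.range (π ^ (m + 1))).index) := by
          rw [ih]; ring

/-- Composing with a bijective endomorphism on the left does not change the kernel. [folklore] -/
theorem ker_mul_of_injective {u : AddMonoid.End A} (hu : Function.Injective u) (h : AddMonoid.End A) :
    AddMonoidHom.ker (u * h) = AddMonoidHom.ker h := by
  ext x
  rw [AddMonoidHom.mem_ker, AddMonoidHom.mem_ker]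
  change u (h x) = 0 ↔ h x = 0
  constructor
  · intro hx
    exact hu (by rw [hx, map_zero])
  · intro hx
    rw [hx, map_zero]

/-- Composing with a bijective endomorphism on the left does not change the index of the image.
[folklore] -/
theorem index_range_mul_of_bijective {u : AddMonoid.End A} (hu : Function.Bijective u)
    (h : AddMonoid.End A) :
    (AddMonoidHom.range (u * h)).index = (AddMonoidHom.range h).index := by
  rw [addMonoidEnd_mul_eq_comp, ← AddMonoidHom.map_range]
  exact AddSubgroup.index_map_of_bijective hu _

end Iterate

/-! ## `Φ_p(X + 1) = X^(p-1) + p·Q` with `Q(0) = 1` (Eisenstein at `p`) -/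

section CyclotomicShift

open Polynomial

/-- **The shifted cyclotomic polynomial is Eisenstein at `p`, explicitly**: there are
`Q, V ∈ ℤ[X]` with `Φ_p(X + 1) = X^(p-1) + p·Q` and `Q = 1 + X·V` (all non-leading coefficients of
the monic `Φ_p(X+1)` are divisible by `p`, the constant one being `Φ_p(1) = p`; Mathlib's
`cyclotomic_comp_X_add_one_isEisensteinAt`). [folklore] -/
theorem exists_cyclotomic_comp_X_add_one_eq (p : ℕ) [hp : Fact p.Prime] :
    ∃ Q V : ℤ[X], (cyclotomic p ℤ).comp (X + 1) = X ^ (p - 1) + C (p : ℤ) * Q ∧ Q = 1 + X * V := by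
  set P : ℤ[X] := (cyclotomic p ℤ).comp (X + 1) with hP
  have hE := cyclotomic_comp_X_add_one_isEisensteinAt p
  have hXC : (X + 1 : ℤ[X]) = X + C 1 := by rw [C_1]
  have hmonic : P.Monic := by
    rw [hP, hXC]
    exact (cyclotomic.monic p ℤ).comp_X_add_C 1
  have hdeg : P.natDegree = p - 1 := by
    rw [hP, natDegree_comp, hXC, natDegree_X_add_C, mul_one, natDegree_cyclotomic,
      Nat.totient_prime hp.out]
  have hdvd : C (p : ℤ) ∣ P - X ^ (p - 1) := by
    rw [C_dvd_iff_dvd_coeff]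
    intro n
    rw [coeff_sub, coeff_X_pow]
    rcases lt_trichotomy n (p - 1) with hn | hn | hn
    · rw [if_neg hn.ne, sub_zero]
      have hmem := hE.mem (by rw [hdeg]; exact hn)
      rwa [Ideal.submodule_span_eq, Ideal.mem_span_singleton] at hmem
    · subst hn
      rw [if_pos rfl, ← hdeg, hmonic.coeff_natDegree, sub_self]
      exact dvd_zero _
    · rw [if_neg hn.ne', sub_zero, coeff_eq_zero_of_natDegree_lt (by rw [hdeg]; exact hn)]
      exact dvd_zero _
  obtain ⟨Q, hQ⟩ := hdvd
  have hPQ : P = X ^ (p - 1) + C (p : ℤ) * Q := by rw [← hQ]; ring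
  -- the constant coefficient of `Q` is `1`
  have h0 : P.coeff 0 = p := by
    rw [coeff_zero_eq_eval_zero, hP, eval_comp, eval_add, eval_X, eval_one, zero_add,
      Polynomial.eval_one_cyclotomic_prime]
  have hp1 : p - 1 ≠ 0 := by have := hp.out.two_le; omega
  have hQ0 : Q.coeff 0 = 1 := by
    have h := congrArg (fun f : ℤ[X] ↦ f.coeff 0) hPQ
    simp only [coeff_add, coeff_X_pow, coeff_C_mul, h0, if_neg (Ne.symm hp1), zero_add] at h
    have hp0 : (p : ℤ) ≠ 0 := by exact_mod_cast hp.out.ne_zero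
    have h' : (p : ℤ) * (Q.coeff 0 - 1) = 0 := by rw [mul_sub, ← h, mul_one, sub_self]
    rcases mul_eq_zero.mp h' with h'' | h''
    · exact absurd h'' hp0
    · exact sub_eq_zero.mp h''
  obtain ⟨V, hV⟩ := (X_dvd_iff (f := Q - 1)).mpr (by rw [coeff_sub, coeff_one_zero, hQ0, sub_self])
  exact ⟨Q, V, hPQ, by rw [← hV]; ring⟩

end CyclotomicShift

/-! ## A `p`-primary group killed by `1 + τ + ⋯ + τ^(p-1)` has corank divisible by `p - 1` -/

section KerNorm

open Polynomial

variable {B : Type*} [AddCommGroup B] (p : ℕ) [hp : Fact p.Prime] (τ : AddMonoid.End B)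

/-- `Φ_p(X + 1)` evaluated at `τ - 1` is `1 + τ + ⋯ + τ^(p-1)`. [folklore] -/
theorem aeval_sub_one_cyclotomic_comp :
    aeval (τ - 1) ((cyclotomic p ℤ).comp (X + 1)) = ∑ i ∈ Finset.range p, τ ^ i := by
  rw [aeval_comp, map_add, aeval_X, map_one, sub_add_cancel, cyclotomic_prime, map_sum]
  simp only [map_pow, aeval_X]

/-- Polynomials in one endomorphism commute. [folklore] -/
theorem aeval_mul_comm (π : AddMonoid.End B) (F G : ℤ[X]) :
    aeval π F * aeval π G = aeval π G * aeval π F := by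
  rw [← map_mul, mul_comm, map_mul]

/-- `(∑ fᵢ) b = ∑ fᵢ b` in `AddMonoid.End`. [folklore] -/
theorem addMonoidEnd_sum_apply {ι : Type*} (s : Finset ι) (f : ι → AddMonoid.End B) (b : B) :
    (∑ i ∈ s, f i) b = ∑ i ∈ s, f i b :=
  AddMonoidHom.finsetSum_apply _ _ _

/-- **The Eisenstein relation on `B`.** If `1 + τ + ⋯ + τ^(p-1) = 0` on `B` then, with `π = τ - 1`
and `Q = 1 + X V` as in `exists_cyclotomic_comp_X_add_one_eq`, `π^(p-1) + p · Q(π) = 0`.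
[folklore] -/
theorem pow_sub_one_add_eq_zero (hτ : ∑ i ∈ Finset.range p, τ ^ i = 0) {Q : ℤ[X]}
    (hPQ : (cyclotomic p ℤ).comp (X + 1) = X ^ (p - 1) + C (p : ℤ) * Q) :
    (τ - 1) ^ (p - 1) + (p : AddMonoid.End B) * aeval (τ - 1) Q = 0 := by
  have h := aeval_sub_one_cyclotomic_comp p τ
  rw [hτ, hPQ, map_add, map_pow, aeval_X, map_mul, aeval_C, algebraMap_int_eq, eq_intCast,
    Int.cast_natCast] at h
  exact h

variable {p τ}

/-- **`π = τ - 1` is locally nilpotent**: if `1 + τ + ⋯ + τ^(p-1) = 0` then `π^((p-1)n)` kills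
`B[p^n]` (`π^(p-1) = -p·Q(π)` with `Q(π)` commuting with `π`). [folklore] -/
theorem pow_apply_eq_zero_of_pow_nsmul_eq_zero (hτ : ∑ i ∈ Finset.range p, τ ^ i = 0)
    (n : ℕ) (b : B) (hb : p ^ n • b = 0) : ((τ - 1) ^ ((p - 1) * n)) b = 0 := by
  obtain ⟨Q, V, hPQ, -⟩ := exists_cyclotomic_comp_X_add_one_eq p
  have hE := pow_sub_one_add_eq_zero p τ hτ hPQ
  set π : AddMonoid.End B := τ - 1 with hπ
  have hcomm : ∀ m : ℕ, π ^ m * aeval π Q = aeval π Q * π ^ m := fun m ↦ by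
    have h := aeval_mul_comm π (X ^ m) Q
    rwa [map_pow, aeval_X] at h
  induction n generalizing b with
  | zero => rw [pow_zero, one_smul] at hb; rw [hb, map_zero]
  | succ n ih =>
    have hstep : (π ^ (p - 1)) b = -(aeval π Q (p • b)) := by
      have h1 : π ^ (p - 1) = -((p : AddMonoid.End B) * aeval π Q) := eq_neg_of_add_eq_zero_left hE
      rw [h1]
      change -(((p : AddMonoid.End B) * aeval π Q) b) = _
      rw [AddMonoid.End.coe_mul, comp_apply, AddMonoid.End.natCast_apply, map_nsmul]
    have hpb : p ^ n • (p • b) = 0 := by rw [smul_smul, ← pow_succ, hb]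
    rw [Nat.mul_succ, pow_add, AddMonoid.End.coe_mul, comp_apply, hstep, map_neg,
      ← comp_apply (f := ⇑(π ^ ((p - 1) * n))) (g := ⇑(aeval π Q)), ← AddMonoid.End.coe_mul,
      hcomm, AddMonoid.End.coe_mul, comp_apply, ih (p • b) hpb, map_zero, neg_zero]

/-- Local nilpotence of `π = τ - 1` on a `p`-primary `B` with `1 + τ + ⋯ + τ^(p-1) = 0`: every
element is killed by a power of `π`. [folklore] -/
theorem exists_pow_apply_eq_zero (hτ : ∑ i ∈ Finset.range p, τ ^ i = 0)
    (hB : ∀ b : B, ∃ n : ℕ, p ^ n • b = 0) (b : B) : ∃ m : ℕ, ((τ - 1) ^ m) b = 0 := by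
  obtain ⟨n, hn⟩ := hB b
  exact ⟨(p - 1) * n, pow_apply_eq_zero_of_pow_nsmul_eq_zero hτ n b hn⟩

/-- If `π^m b = 0` then `(F · X^m)(π) b = 0`. [folklore] -/
theorem aeval_mul_X_pow_apply_eq_zero (π : AddMonoid.End B) (F : ℤ[X]) {m : ℕ} {b : B}
    (hb : (π ^ m) b = 0) : aeval π (F * X ^ m) b = 0 := by
  rw [map_mul, map_pow, aeval_X, AddMonoid.End.coe_mul, comp_apply, hb, map_zero]

/-- **`Q(π) = 1 + π V(π)` is injective** on a `p`-primary `B` (`π` locally nilpotent): if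
`Q(π) b = 0` then `b = (-π V(π))^m b` for all `m`, which vanishes for `m` large. [folklore] -/
theorem aeval_injective_of_eq_one_add (hτ : ∑ i ∈ Finset.range p, τ ^ i = 0)
    (hB : ∀ b : B, ∃ n : ℕ, p ^ n • b = 0) {Q V : ℤ[X]} (hQV : Q = 1 + X * V) :
    Function.Injective (aeval (τ - 1) Q) := by
  set π : AddMonoid.End B := τ - 1 with hπ
  rw [injective_iff_map_eq_zero]
  intro b hb
  -- `b = Y(π) b` with `Y = -(X V)`, hence `b = Y^m(π) b` for all `m`
  have hY : ∀ m : ℕ, aeval π ((-(X * V)) ^ m) b = b := by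
    intro m
    induction m with
    | zero => rw [pow_zero, map_one]; rfl
    | succ m ih =>
      have h1 : aeval π (-(X * V)) b = b := by
        have h2 : aeval π Q b = aeval π (1 + X * V) b := by rw [hQV]
        rw [hb, map_add, map_one] at h2
        change (0 : B) = b + aeval π (X * V) b at h2
        rw [map_neg]
        change -(aeval π (X * V) b) = b
        rw [neg_eq_iff_add_eq_zero, add_comm]
        exact h2.symm
      conv_rhs => rw [← ih, ← h1]
      rw [pow_succ, map_mul, AddMonoid.End.coe_mul, comp_apply]
  obtain ⟨m, hm⟩ := exists_pow_apply_eq_zero hτ hB b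
  rw [← hY m, neg_pow, mul_pow, show (-1 : ℤ[X]) ^ m * (X ^ m * V ^ m) = ((-1) ^ m * V ^ m) * X ^ m
    by ring]
  exact aeval_mul_X_pow_apply_eq_zero π _ hm

/-- **`Q(π) = 1 + π V(π)` is surjective** on a `p`-primary `B`: if `π^m b = 0` then
`b = Q(π) · (∑_{j<m} (-π V(π))^j) b` (geometric series). [folklore] -/
theorem aeval_surjective_of_eq_one_add (hτ : ∑ i ∈ Finset.range p, τ ^ i = 0)
    (hB : ∀ b : B, ∃ n : ℕ, p ^ n • b = 0) {Q V : ℤ[X]} (hQV : Q = 1 + X * V) :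
    Function.Surjective (aeval (τ - 1) Q) := by
  set π : AddMonoid.End B := τ - 1 with hπ
  intro b
  obtain ⟨m, hm⟩ := exists_pow_apply_eq_zero hτ hB b
  refine ⟨aeval π (∑ j ∈ Finset.range m, (-(X * V)) ^ j) b, ?_⟩
  rw [← comp_apply (f := ⇑(aeval π Q)), ← AddMonoid.End.coe_mul, ← map_mul,
    show Q = 1 - -(X * V) by rw [hQV]; ring, mul_neg_geom_sum, map_sub, map_one]
  change b - aeval π ((-(X * V)) ^ m) b = b
  rw [neg_pow, mul_pow, show (-1 : ℤ[X]) ^ m * (X ^ m * V ^ m) = ((-1) ^ m * V ^ m) * X ^ m by ring,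
    aeval_mul_X_pow_apply_eq_zero π _ hm, sub_zero]

omit hp in
/-- **`ker (τ - 1) ⊆ B[p]`**: a `τ`-fixed element `b` has `p • b = (1 + τ + ⋯ + τ^(p-1)) b = 0`.
[folklore] -/
theorem nsmul_eq_zero_of_mem_ker_sub_one (hτ : ∑ i ∈ Finset.range p, τ ^ i = 0) {b : B}
    (hb : b ∈ AddMonoidHom.ker (τ - 1)) : p • b = 0 := by
  rw [AddMonoidHom.mem_ker] at hb
  change τ b - b = 0 at hb
  rw [sub_eq_zero] at hb
  have hi : ∀ i : ℕ, (τ ^ i) b = b := fun i ↦ by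
    induction i with
    | zero => rfl
    | succ i ih => rw [pow_succ, AddMonoid.End.coe_mul, comp_apply, hb, ih]
  have h := congrArg (fun f : AddMonoid.End B ↦ f b) hτ
  simp only [addMonoidEnd_sum_apply, hi, Finset.sum_const, Finset.card_range] at h
  exact h

/-- **`pB ⊆ (τ - 1)B`**: `p • b = -π^(p-1) c` where `b = Q(π) c`. [folklore] -/
theorem nsmul_mem_range_sub_one (hτ : ∑ i ∈ Finset.range p, τ ^ i = 0)
    (hB : ∀ b : B, ∃ n : ℕ, p ^ n • b = 0) (b : B) : p • b ∈ AddMonoidHom.range (τ - 1) := by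
  obtain ⟨Q, V, hPQ, hQV⟩ := exists_cyclotomic_comp_X_add_one_eq p
  have hE := pow_sub_one_add_eq_zero p τ hτ hPQ
  set π : AddMonoid.End B := τ - 1 with hπ
  obtain ⟨c, rfl⟩ := aeval_surjective_of_eq_one_add hτ hB hQV b
  have h1 : (p : AddMonoid.End B) * aeval π Q = -π ^ (p - 1) := eq_neg_of_add_eq_zero_right hE
  have hp1 : p - 1 = (p - 2) + 1 := by have := hp.out.two_le; omega
  refine ⟨-((π ^ (p - 2)) c), ?_⟩
  rw [map_neg, ← AddMonoid.End.natCast_apply, ← comp_apply (f := ⇑(p : AddMonoid.End B)),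
    ← AddMonoid.End.coe_mul, h1]
  change -(π ((π ^ (p - 2)) c)) = -((π ^ (p - 1)) c)
  rw [hp1, pow_succ', AddMonoid.End.coe_mul, comp_apply]

end KerNorm

/-! ## The corank of `ker (1 + τ + ⋯ + τ^(p-1))`-type groups is divisible by `p - 1` -/

section Divisible

open Polynomial

variable {B : Type*} [AddCommGroup B] {p : ℕ} [hp : Fact p.Prime] {τ : AddMonoid.End B}

/-- The order of a finite abelian group killed by a prime `p` is a power of `p`. [folklore] -/
theorem exists_natCard_eq_prime_pow_of_nsmul_eq_zero (X : Type*) [AddCommGroup X] [Finite X]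
    (hX : ∀ x : X, p • x = 0) : ∃ a : ℕ, Nat.card X = p ^ a := by
  letI : Module (ZMod p) X := AddCommGroup.zmodModule hX
  exact ⟨Module.finrank (ZMod p) X, (pow_finrank_eq_natCard (p := p) X).symm⟩

omit hp in
/-- The kernel of multiplication by `p` (as an element of `AddMonoid.End B`) is `B[p]`, in
cardinality. [folklore] -/
theorem natCard_ker_natCast_eq : Nat.card (AddMonoidHom.ker (p : AddMonoid.End B)) =
    Nat.card B[(p : ℤ)] := by
  refine Nat.card_congr (Equiv.subtypeEquivRight fun x ↦ ?_)
  rw [AddMonoidHom.mem_ker, AddSubgroup.torsionBy.nsmul_iff]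
  exact Iff.of_eq (congrArg (· = 0) (AddMonoid.End.natCast_apply p x))

omit hp in
/-- The image of multiplication by `p` (as an element of `AddMonoid.End B`) is `pB`, so its index
is `#(B/pB)`. [folklore] -/
theorem index_range_natCast_eq :
    (AddMonoidHom.range (p : AddMonoid.End B)).index = Nat.card (ModN B p) := by
  have h : AddMonoidHom.range (p : AddMonoid.End B) =
      (LinearMap.range (LinearMap.lsmul ℤ B p)).toAddSubgroup := by
    ext x
    simp only [AddMonoidHom.mem_range, Submodule.mem_toAddSubgroup, LinearMap.mem_range,
      LinearMap.lsmul_apply]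
    constructor
    · rintro ⟨b, rfl⟩
      exact ⟨b, by rw [Nat.cast_smul_eq_nsmul]; exact (AddMonoid.End.natCast_apply p b).symm⟩
    · rintro ⟨b, rfl⟩
      exact ⟨b, by rw [Nat.cast_smul_eq_nsmul]; exact AddMonoid.End.natCast_apply p b⟩
  rw [h, AddSubgroup.index_eq_card]
  rfl

/-- **A `p`-primary abelian group with finite `p`-torsion on which an endomorphism `τ` satisfies
`1 + τ + ⋯ + τ^(p-1) = 0` has `ℤ_p`-corank divisible by `p - 1`** (i.e. a cofinitely generated
torsion `ℤ_p[ζ_p]`-module has `ℤ_p`-corank divisible by `[ℚ_p(ζ_p) : ℚ_p] = p - 1`; this is the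
content of "the non-trivial `ℚ_p`-irreducible representation of `C_p` has dimension `p - 1`" in
Dokchitser–Dokchitser, Ann. of Math. 172 (2010), proof of Cor. 4.15). Proof: with `π = τ - 1`,
`Φ_p(X+1) = X^(p-1) + pQ` Eisenstein gives `π^(p-1) = -p·Q(π)` with `Q(π)` an automorphism, so
`#B[p]·[B:πB]^(p-1) = (#ker π)^(p-1)·#(B/pB)` (`natCard_ker_pow_mul_index_pow`), where `ker π ⊆ B[p]`
and `B/πB` (a quotient of `B/pB`) are finite groups killed by `p`; reading orders as powers of `p`,
`corank = (p-1)(a-b)`. [cite: DokchitserDokchitserAnnals2010, Cor. 4.15 (proof)] -/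
theorem exists_zpCorank_eq_mul_of_sum_pow_eq_zero (hτ : ∑ i ∈ Finset.range p, τ ^ i = 0)
    (hB : ∀ b : B, ∃ n : ℕ, p ^ n • b = 0) [Finite B[(p : ℤ)]] :
    ∃ k : ℕ, zpCorank B p = (p - 1) * k := by
  obtain ⟨Q, V, hPQ, hQV⟩ := exists_cyclotomic_comp_X_add_one_eq p
  have hE := pow_sub_one_add_eq_zero p τ hτ hPQ
  have hqinj : Function.Injective (aeval (τ - 1) Q) := aeval_injective_of_eq_one_add hτ hB hQV
  have hqsurj : Function.Surjective (aeval (τ - 1) Q) := aeval_surjective_of_eq_one_add hτ hB hQV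
  set π : AddMonoid.End B := τ - 1 with hπ
  set q : AddMonoid.End B := aeval π Q with hq
  -- `π^(p-1) = (-q) ∘ p`
  have hfactor : π ^ (p - 1) = (-q) * (p : AddMonoid.End B) := by
    rw [neg_mul, ← (Nat.cast_commute p q).eq]
    exact eq_neg_of_add_eq_zero_left hE
  have hnqinj : Function.Injective (-q) := fun a b h ↦ by
    change -(q a) = -(q b) at h
    exact hqinj (neg_inj.mp h)
  have hnqsurj : Function.Surjective (-q) := fun b ↦ by
    obtain ⟨c, hc⟩ := hqsurj (-b)
    exact ⟨c, by change -(q c) = b; rw [← neg_neg b]; exact congrArg Neg.neg hc⟩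
  have hker : Nat.card (AddMonoidHom.ker (π ^ (p - 1))) = Nat.card B[(p : ℤ)] := by
    rw [hfactor, ker_mul_of_injective hnqinj, natCard_ker_natCast_eq]
  have hidx : (AddMonoidHom.range (π ^ (p - 1))).index = Nat.card (ModN B p) := by
    rw [hfactor, index_range_mul_of_bijective ⟨hnqinj, hnqsurj⟩, index_range_natCast_eq]
  -- finiteness of `B/pB`, hence of `B/πB`
  obtain ⟨hfinModN, -⟩ := finite_modN_of_primary hB
  have hModN0 : Nat.card (ModN B p) ≠ 0 := (Nat.card_pos (α := ModN B p)).ne'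
  have hle : AddMonoidHom.range (p : AddMonoid.End B) ≤ AddMonoidHom.range π := by
    rintro _ ⟨b, rfl⟩
    change (p : AddMonoid.End B) b ∈ AddMonoidHom.range π
    rw [AddMonoid.End.natCast_apply]
    exact nsmul_mem_range_sub_one hτ hB b
  have hc1 : (AddMonoidHom.range π).index ≠ 0 := by
    intro h0
    have hdvd := AddSubgroup.index_dvd_of_le hle
    rw [h0, zero_dvd_iff, index_range_natCast_eq] at hdvd
    exact hModN0 hdvd
  -- the iterate identity at `m = p - 1`
  have hiter := natCard_ker_pow_mul_index_pow π hc1 (p - 1)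
  rw [hker, hidx, ← pow_zpCorank_mul_natCard_modN hB] at hiter
  -- `#ker π = p^a`, `[B : πB] = p^b`
  haveI : Finite (AddMonoidHom.ker π) := by
    refine Finite.of_injective (fun x : AddMonoidHom.ker π ↦ (⟨(x : B),
      AddSubgroup.torsionBy.nsmul_iff.mpr (nsmul_eq_zero_of_mem_ker_sub_one hτ x.2)⟩ : B[(p : ℤ)]))
      fun x y hxy ↦ Subtype.ext (congrArg (fun z : B[(p : ℤ)] ↦ (z : B)) hxy)
  obtain ⟨a, ha⟩ := exists_natCard_eq_prime_pow_of_nsmul_eq_zero (p := p) (AddMonoidHom.ker π) fun x ↦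
    Subtype.ext (by
      rw [AddSubgroupClass.coe_nsmul, ZeroMemClass.coe_zero]
      exact nsmul_eq_zero_of_mem_ker_sub_one hτ x.2)
  haveI : Finite (B ⧸ AddMonoidHom.range π) := (AddSubgroup.fintypeOfIndexNeZero hc1).finite
  obtain ⟨b, hb⟩ := exists_natCard_eq_prime_pow_of_nsmul_eq_zero (p := p) (B ⧸ AddMonoidHom.range π)
    fun x ↦ by
      induction x using QuotientAddGroup.induction_on with
      | H y =>
        rw [← QuotientAddGroup.mk_nsmul, QuotientAddGroup.eq_zero_iff]
        exact nsmul_mem_range_sub_one hτ hB y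
  rw [← AddSubgroup.index_eq_card] at hb
  rw [ha, hb] at hiter
  -- `p^r · M · p^(b(p-1)) = p^(a(p-1)) · M`
  refine ⟨a - b, ?_⟩
  have h1 : p ^ (zpCorank B p + b * (p - 1)) = p ^ (a * (p - 1)) := by
    apply Nat.eq_of_mul_eq_mul_right (Nat.pos_of_ne_zero hModN0)
    calc p ^ (zpCorank B p + b * (p - 1)) * Nat.card (ModN B p)
        = p ^ zpCorank B p * Nat.card (ModN B p) * (p ^ b) ^ (p - 1) := by ring
      _ = (p ^ a) ^ (p - 1) * Nat.card (ModN B p) := hiter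
      _ = p ^ (a * (p - 1)) * Nat.card (ModN B p) := by ring
  have h2 := Nat.pow_right_injective hp.out.two_le h1
  have h3 : zpCorank B p = a * (p - 1) - b * (p - 1) := by omega
  rw [h3, ← Nat.sub_mul, mul_comm]

end Divisible

/-! ## An automorphism of order `p`: `corank A = corank A^σ + (p - 1)·k` -/

section OrderP

variable {A : Type*} [AddCommGroup A] {p : ℕ} [hp : Fact p.Prime] (σ : AddMonoid.End A)

/-- An element of `AddMonoid.End A` regarded as an additive homomorphism `A →+ A` (the identity
map, spelled out so that kernels of ring-theoretic expressions in `σ` are well-typed subgroups).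
[folklore] -/
def endHom (e : AddMonoid.End A) : A →+ A := e

omit hp in
/-- `endHom e x = e x`. [folklore] -/
@[simp]
theorem endHom_apply (e : AddMonoid.End A) (x : A) : endHom e x = e x := rfl

/-- The norm element `N_σ = 1 + σ + ⋯ + σ^(p-1)` of the cyclic group generated by an endomorphism
`σ` with `σ^p = 1`. [folklore] -/
def normEnd (p : ℕ) : AddMonoid.End A := ∑ i ∈ Finset.range p, σ ^ i

omit hp in
/-- `N_σ x = ∑_{i<p} σ^i x`. [folklore] -/
theorem normEnd_apply (x : A) : normEnd σ p x = ∑ i ∈ Finset.range p, (σ ^ i) x :=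
  addMonoidEnd_sum_apply _ _ x

/-- The `σ`-fixed subgroup `A^σ = ker (σ - 1)`. [folklore] -/
def fixedSub : AddSubgroup A := AddMonoidHom.ker (endHom (σ - 1))

omit hp in
/-- `x ∈ A^σ ↔ σ x = x`. [folklore] -/
theorem mem_fixedSub_iff (x : A) : x ∈ fixedSub σ ↔ σ x = x := by
  rw [fixedSub, AddMonoidHom.mem_ker, endHom_apply]
  exact sub_eq_zero

/-- The subgroup `ker N_σ`. [folklore] -/
def kerNorm (p : ℕ) : AddSubgroup A := AddMonoidHom.ker (endHom (normEnd σ p))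

omit hp in
/-- `x ∈ ker N_σ ↔ N_σ x = 0`. [folklore] -/
theorem mem_kerNorm_iff (x : A) : x ∈ kerNorm σ p ↔ normEnd σ p x = 0 :=
  AddMonoidHom.mem_ker

variable {σ}

omit hp in
/-- `σ ∘ N_σ = N_σ` when `σ^p = 1` (rotation of the sum). [folklore] -/
theorem mul_normEnd (hσ : σ ^ p = 1) : σ * normEnd σ p = normEnd σ p := by
  have h : σ * normEnd σ p = ∑ i ∈ Finset.range p, σ ^ (i + 1) := by
    unfold normEnd
    rw [Finset.mul_sum]
    exact Finset.sum_congr rfl fun i _ ↦ (pow_succ' σ i).symm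
  have h1 := Finset.sum_range_succ' (fun i ↦ σ ^ i) p
  have h2 := Finset.sum_range_succ (fun i ↦ σ ^ i) p
  rw [pow_zero] at h1
  rw [hσ] at h2
  rw [h]
  exact add_right_cancel (h1.symm.trans h2)

omit hp in
/-- `N_σ ∘ σ = N_σ` when `σ^p = 1`. [folklore] -/
theorem normEnd_mul (hσ : σ ^ p = 1) : normEnd σ p * σ = normEnd σ p := by
  have h : normEnd σ p * σ = ∑ i ∈ Finset.range p, σ ^ (i + 1) := by
    unfold normEnd
    rw [Finset.sum_mul]
    exact Finset.sum_congr rfl fun i _ ↦ (pow_succ σ i).symm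
  have h1 := Finset.sum_range_succ' (fun i ↦ σ ^ i) p
  have h2 := Finset.sum_range_succ (fun i ↦ σ ^ i) p
  rw [pow_zero] at h1
  rw [hσ] at h2
  rw [h]
  exact add_right_cancel (h1.symm.trans h2)

omit hp in
/-- `σ^i ∘ N_σ = N_σ`. [folklore] -/
theorem pow_mul_normEnd (hσ : σ ^ p = 1) (i : ℕ) : σ ^ i * normEnd σ p = normEnd σ p := by
  induction i with
  | zero => rw [pow_zero, one_mul]
  | succ i ih => rw [pow_succ, mul_assoc, mul_normEnd hσ, ih]

omit hp in
/-- `N_σ ∘ N_σ = p · N_σ`. [folklore] -/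
theorem normEnd_mul_normEnd (hσ : σ ^ p = 1) :
    normEnd σ p * normEnd σ p = (p : AddMonoid.End A) * normEnd σ p :=
  calc normEnd σ p * normEnd σ p
      = ∑ i ∈ Finset.range p, σ ^ i * normEnd σ p := Finset.sum_mul _ _ _
    _ = ∑ i ∈ Finset.range p, normEnd σ p := Finset.sum_congr rfl fun i _ ↦ pow_mul_normEnd hσ i
    _ = (p : AddMonoid.End A) * normEnd σ p := by
        rw [Finset.sum_const, Finset.card_range, nsmul_eq_mul]

omit hp in
/-- `N_σ x` is `σ`-fixed. [folklore] -/
theorem normEnd_apply_mem_fixedSub (hσ : σ ^ p = 1) (x : A) : normEnd σ p x ∈ fixedSub σ := by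
  rw [mem_fixedSub_iff]
  change (σ * normEnd σ p) x = normEnd σ p x
  rw [mul_normEnd hσ]

omit hp in
/-- `p • x - N_σ x ∈ ker N_σ` (`N_σ² = p N_σ`). [folklore] -/
theorem nsmul_sub_normEnd_apply_mem_kerNorm (hσ : σ ^ p = 1) (x : A) :
    p • x - normEnd σ p x ∈ kerNorm σ p := by
  rw [mem_kerNorm_iff, map_sub, map_nsmul]
  change p • normEnd σ p x - (normEnd σ p * normEnd σ p) x = 0
  rw [normEnd_mul_normEnd hσ]
  change p • normEnd σ p x - p • normEnd σ p x = 0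
  rw [sub_self]

omit hp in
/-- On `σ`-fixed elements `N_σ` is multiplication by `p`. [folklore] -/
theorem normEnd_apply_of_mem_fixedSub {x : A} (hx : x ∈ fixedSub σ) : normEnd σ p x = p • x := by
  rw [mem_fixedSub_iff] at hx
  have hi : ∀ i : ℕ, (σ ^ i) x = x := fun i ↦ by
    induction i with
    | zero => rfl
    | succ i ih => rw [pow_succ, AddMonoid.End.coe_mul, comp_apply, hx, ih]
  simp only [normEnd_apply, hi, Finset.sum_const, Finset.card_range]

omit hp in
/-- `σ` preserves `ker N_σ`. [folklore] -/
theorem apply_mem_kerNorm (hσ : σ ^ p = 1) {x : A} (hx : x ∈ kerNorm σ p) : σ x ∈ kerNorm σ p := by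
  rw [mem_kerNorm_iff] at hx ⊢
  change (normEnd σ p * σ) x = 0
  rw [normEnd_mul hσ]
  exact hx

/-- The restriction `τ` of `σ` to `B = ker N_σ`. [folklore] -/
def restrictKerNorm (hσ : σ ^ p = 1) : AddMonoid.End (kerNorm σ p) :=
  ((endHom σ).comp (kerNorm σ p).subtype).codRestrict (kerNorm σ p) fun x ↦ apply_mem_kerNorm hσ x.2

omit hp in
/-- Values of the restriction. [folklore] -/
@[simp]
theorem coe_restrictKerNorm_apply (hσ : σ ^ p = 1) (x : kerNorm σ p) :
    ((restrictKerNorm hσ x : kerNorm σ p) : A) = σ x :=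
  rfl

omit hp in
/-- Values of the powers of the restriction. [folklore] -/
theorem coe_restrictKerNorm_pow_apply (hσ : σ ^ p = 1) (i : ℕ) (x : kerNorm σ p) :
    (((restrictKerNorm hσ ^ i) x : kerNorm σ p) : A) = (σ ^ i) x := by
  induction i generalizing x with
  | zero => rfl
  | succ i ih =>
    rw [pow_succ, pow_succ, AddMonoid.End.coe_mul, AddMonoid.End.coe_mul, comp_apply, comp_apply,
      ih, coe_restrictKerNorm_apply]

omit hp in
/-- On `B = ker N_σ` the restriction `τ` of `σ` satisfies `1 + τ + ⋯ + τ^(p-1) = 0`. [folklore] -/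
theorem sum_pow_restrictKerNorm_eq_zero (hσ : σ ^ p = 1) :
    ∑ i ∈ Finset.range p, restrictKerNorm hσ ^ i = 0 := by
  apply AddMonoidHom.ext
  intro x
  apply Subtype.ext
  change (((∑ i ∈ Finset.range p, restrictKerNorm hσ ^ i) x : kerNorm σ p) : A) =
    (((0 : AddMonoid.End (kerNorm σ p)) x : kerNorm σ p) : A)
  have h : (((∑ i ∈ Finset.range p, restrictKerNorm hσ ^ i) x : kerNorm σ p) : A) =
      ∑ i ∈ Finset.range p, (((restrictKerNorm hσ ^ i) x : kerNorm σ p) : A) := by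
    rw [← AddSubmonoidClass.coe_finsetSum]
    exact congrArg Subtype.val (addMonoidEnd_sum_apply _ _ x)
  rw [h]
  simp_rw [coe_restrictKerNorm_pow_apply]
  rw [← normEnd_apply]
  exact (mem_kerNorm_iff σ x).mp x.2

/-- The map `A^σ × ker N_σ → A`, `(a, b) ↦ a + b`. [folklore] -/
def fixedKerMap (σ : AddMonoid.End A) (p : ℕ) : (fixedSub σ) × (kerNorm σ p) →+ A :=
  AddMonoidHom.coprod (fixedSub σ).subtype (kerNorm σ p).subtype

omit hp in
/-- The kernel of `A^σ × ker N_σ → A` is killed by `p` (`A^σ ∩ ker N_σ ⊆ A[p]`). [folklore] -/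
theorem nsmul_eq_zero_of_fixedKerMap_eq_zero (x : (fixedSub σ) × (kerNorm σ p))
    (hx : fixedKerMap σ p x = 0) : p • x = 0 := by
  obtain ⟨a, b⟩ := x
  change (a : A) + b = 0 at hx
  have hab : (a : A) = -b := eq_neg_of_add_eq_zero_left hx
  have hpa : p • (a : A) = 0 := by
    rw [← normEnd_apply_of_mem_fixedSub a.2, hab, map_neg, neg_eq_zero]
    exact (mem_kerNorm_iff σ _).mp b.2
  have hpb : p • (b : A) = 0 := by
    rw [← neg_neg (b : A), ← hab, smul_neg, hpa, neg_zero]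
  refine Prod.ext (Subtype.ext ?_) (Subtype.ext ?_)
  · rw [Prod.smul_fst, AddSubgroupClass.coe_nsmul]; exact hpa
  · rw [Prod.smul_snd, AddSubgroupClass.coe_nsmul]; exact hpb

omit hp in
/-- The cokernel of `A^σ × ker N_σ → A` is killed by `p`: `p • x = N_σ x + (p • x - N_σ x)`.
[folklore] -/
theorem nsmul_mem_range_fixedKerMap (hσ : σ ^ p = 1) (x : A) : p • x ∈ (fixedKerMap σ p).range :=
  ⟨(⟨normEnd σ p x, normEnd_apply_mem_fixedSub hσ x⟩, ⟨p • x - normEnd σ p x,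
    nsmul_sub_normEnd_apply_mem_kerNorm hσ x⟩), by
      change normEnd σ p x + (p • x - normEnd σ p x) = p • x
      abel⟩

/-- **An automorphism of prime order `p` on a cofinitely generated `p`-primary group:
`corank A = corank A^σ + (p - 1) k`.** For an abelian `p`-primary group `A` with finite
`p`-torsion and an endomorphism `σ` with `σ^p = 1`, the `ℤ_p`-corank of `A` exceeds that of the
fixed subgroup `A^σ = ker (σ - 1)` (`fixedSub σ`) by a multiple of `p - 1`: `A^σ × ker N_σ → A` is a
quasi-isomorphism (kernel and cokernel killed by `p`), and `ker N_σ` has corank divisible by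
`p - 1` (`exists_zpCorank_eq_mul_of_sum_pow_eq_zero`). This is the module-theoretic content of
"a cyclic group of order `p` has only two `ℚ_p`-irreducible `p`-adic representations, the trivial
one and one of dimension `p - 1`" (Dokchitser–Dokchitser, Ann. of Math. 172 (2010), proof of
Cor. 4.15), on the Pontryagin-dual side. [cite: DokchitserDokchitserAnnals2010, Cor. 4.15 (proof)] -/
theorem exists_zpCorank_eq_zpCorank_fixedSub_add (hσ : σ ^ p = 1)
    (hA : ∀ a : A, ∃ n : ℕ, p ^ n • a = 0) [Finite A[(p : ℤ)]] :
    ∃ k : ℕ, zpCorank A p = zpCorank (fixedSub σ) p + (p - 1) * k := by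
  obtain ⟨hF, hFfin⟩ := primary_and_finite_torsionBy_of_injective (i := (fixedSub σ).subtype)
    Subtype.val_injective hA
  obtain ⟨hB, hBfin⟩ := primary_and_finite_torsionBy_of_injective (i := (kerNorm σ p).subtype)
    Subtype.val_injective hA
  haveI := hFfin
  haveI := hBfin
  -- the product is `p`-primary with finite `p`-torsion
  have hi : Injective (AddMonoidHom.inl (fixedSub σ) (kerNorm σ p)) := fun a b h ↦
    (Prod.ext_iff.mp h).1
  have hex : ∀ x : (fixedSub σ) × (kerNorm σ p), AddMonoidHom.snd _ _ x = 0 →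
      x ∈ (AddMonoidHom.inl (fixedSub σ) (kerNorm σ p)).range :=
    fun x hx ↦ ⟨x.1, Prod.ext rfl (by simpa using hx.symm)⟩
  have hfi : ∀ a : fixedSub σ, AddMonoidHom.snd _ (kerNorm σ p) (AddMonoidHom.inl _ _ a) = 0 :=
    fun _ ↦ rfl
  obtain ⟨hFB, hFBfin⟩ := primary_and_finite_torsionBy_of_shortExact hi hex hfi hF hB
  haveI := hFBfin
  -- quasi-isomorphism invariance and the product formula
  have h1 : zpCorank ((fixedSub σ) × (kerNorm σ p)) p = zpCorank A p :=
    zpCorank_eq_of_nsmul_ker_of_nsmul_coker (fixedKerMap σ p) hFB hA hp.out.ne_zero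
      nsmul_eq_zero_of_fixedKerMap_eq_zero (nsmul_mem_range_fixedKerMap hσ)
  have h2 : zpCorank ((fixedSub σ) × (kerNorm σ p)) p = zpCorank (fixedSub σ) p +
      zpCorank (kerNorm σ p) p := zpCorank_prod hF hB
  obtain ⟨k, hk⟩ := exists_zpCorank_eq_mul_of_sum_pow_eq_zero (sum_pow_restrictKerNorm_eq_zero hσ) hB
  exact ⟨k, by rw [← h1, h2, hk]⟩

/-- **Parity form** (`p` odd): `corank A ≡ corank A^σ (mod 2)` — "the parity of the
`p^∞`-Selmer rank is unchanged", once `A^σ` is identified with the Selmer group downstairs.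
[cite: DokchitserDokchitserAnnals2010, Cor. 4.15 (proof)] -/
theorem zpCorank_mod_two_eq_zpCorank_fixedSub_mod_two (hσ : σ ^ p = 1) (hp2 : p ≠ 2)
    (hA : ∀ a : A, ∃ n : ℕ, p ^ n • a = 0) [Finite A[(p : ℤ)]] :
    zpCorank A p % 2 = zpCorank (fixedSub σ) p % 2 := by
  obtain ⟨k, hk⟩ := exists_zpCorank_eq_zpCorank_fixedSub_add hσ hA
  obtain ⟨m, hm⟩ := hp.out.odd_of_ne_two hp2
  have h2 : (p - 1) * k = 2 * (m * k) := by rw [show p - 1 = 2 * m by omega, mul_assoc]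
  rw [hk, h2, Nat.add_mul_mod_self_left]

end OrderP

end Literature.NumberTheory.EllipticCurves

end
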